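import Literature.Analysis.FluidPDE.ForwardOseenPotentials
import HarnessLib

/-!
# The terms of the localised duality identity as pairings with forward potentials

Analysis/FluidPDE support file (everything proved, no definitions) in the decomposition of the
named fact `Literature.Analysis.FluidPDE.LemarieRieusset2016.lemma13_6_duhamel`
(`CKNMorreyHolder.lean`: Lemarié-Rieusset 2016, §13.9 Step 3, (13.50)–(13.52), Lemma 13.6,
pp. 474–478). The duality form of the localised Navier–Stokes equations
(`CKNMorreyDualIdentity.integral_cutoff_mul_test_mul_inner_eq_nu`) expresses `∫ φ g u_c` as a sum
of pairings `∫ F · X` of integrable data `F` (products of the cut-off or its derivatives with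
`u`, `|u|²`, `p`, `f`) with the caloric test fields `X ∈ {η, ∂ᵥη, Ξ, ∂ᵥΞ, ∂ᵤ∂ᵥΞ, L}` generated by
the test function `g`. This file converts each pairing into `∫ g̃ · P` with `P` an explicit
**forward** potential of `F` — the form in which the terms enter the slots of
`LocalisedDuhamelData.potential` — by the duality passage (`duality_term_sliceBound_integrable`,
`duality_term_offDiag`) and the forward identifications of `ForwardHeatPotentials.lean` /
`ForwardOseenPotentials.lean`:

* `pairing_heatDuhamelBack_eq` — `∫ F η = ∫ g̃ · heatPotential ν F`;
* `pairing_fderiv_heatDuhamelBack_eq` — `∫ F ∂ᵥη = ∫ g̃ · (-Re σᵥ(D)-potential of F)`;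
* `pairing_newtonFarSmoothing_eq` — `∫ F L = ∫ g̃ · heatPotential ν (∂_cλ-smeared F)`;
* `pairing_fderiv_fderiv_newtonNear_eq` — `∫ F ∂ᵤ∂ᵥΞ = ∫ g̃ · (-Re Oseen-multiplier potential of F
  + heatPotential ν (profile-smeared F))`;
* `pairing_heatDuhamelBack_eq_reflect`, `pairing_newtonNear_eq_reflect`,
  `pairing_fderiv_newtonNear_eq_reflect` — `∫ F X = ∫ g̃ · (w ↦ ∫ Ǩ(w - z) F(z) dz)` with the
  reflected backward kernels of the heat, `heatD1 Γ₀` and (for separated supports) `heatD2 Γ₀`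
  families (the far-field terms, re-expanded downstream).

## References

* P. G. Lemarié-Rieusset, *The Navier–Stokes Problem in the 21st Century*, CRC Press (2016),
  §13.9 Step 3, (13.50)–(13.52) pp. 474–475; Lemma 13.6 p. 478. [LemarieRieusset2016]
* G. Seregin, V. Šverák, in *Sobolev spaces in mathematics II* (2009), §2 (duality argument).
-/

noncomputable section

open MeasureTheory Set Function Filter Metric Real ContinuousLinearMap TopologicalSpace
open scoped ENNReal NNReal Topology RealInnerProductSpace Convolution

namespace Literature.Analysis.FluidPDE

variable {g : ℝ → EuclideanSpace ℝ (Fin 3) → ℝ} {ν : ℝ} {F : ℝ × EuclideanSpace ℝ (Fin 3) → ℝ}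
  {a b : ℝ}

/-- The reflected potential as an explicit integral `∫ Ǩ(w - z) F(z) dz`. [folklore] -/
theorem convolution_reflect_eq_integral (K : ℝ × EuclideanSpace ℝ (Fin 3) → ℝ)
    (F : ℝ × EuclideanSpace ℝ (Fin 3) → ℝ) (w : ℝ × EuclideanSpace ℝ (Fin 3)) :
    ((fun v => K (-v)) ⋆[lsmul ℝ ℝ, (volume : Measure (ℝ × EuclideanSpace ℝ (Fin 3)))] F) w =
      ∫ z, (fun v => K (-v)) (w - z) * F z :=
  convolution_lsmul_real_prod_apply _ F w

section Pairings

variable (hg : IsSpaceTimeTestOn (⊤ : Opens (ℝ × EuclideanSpace ℝ (Fin 3))) g) (hν : 0 < ν)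
  (hFi : Integrable F volume)
  (hFsupp : ∀ᵐ z ∂(volume : Measure (ℝ × EuclideanSpace ℝ (Fin 3))), F z ≠ 0 → z.1 ∈ Icc a b)
include hg hν hFi hFsupp

/-- **`∫ F η = ∫ g̃ · heatPotential ν F`** (`η = 𝒰_ν[g]`). [folklore] -/
theorem pairing_heatDuhamelBack_eq :
    ∫ z, F z * heatDuhamelBack ν g z.1 z.2 = ∫ w, g w.1 w.2 * heatPotential ν F w := by
  have hK := (isSliceBoundKernel_backKernel_heatKernel (E := EuclideanSpace ℝ (Fin 3))).timeScale hν
  have h := duality_term_sliceBound_integrable (κ := fun a y => UnboundedOperators.heatKernel (ν * a) y)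
    hK hg (X := fun z => heatDuhamelBack ν g z.1 z.2)
    (fun z _ => heatDuhamelBack_eq_convolution_heatKernel_nu hg hν z.1 z.2) hFi hFsupp
  rw [h]
  refine integral_congr_ae (Eventually.of_forall fun w => ?_)
  simp only [uncurry]
  rw [convolution_reflect_backKernel_heatKernel ν F w]

/-- The same with the potential kept as `∫ Ǩ(w - z) F(z) dz` (far-field form). [folklore] -/
theorem pairing_heatDuhamelBack_eq_reflect :
    ∫ z, F z * heatDuhamelBack ν g z.1 z.2 =
      ∫ w, g w.1 w.2 * ∫ z, (fun v => backKernel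
        (fun a y => UnboundedOperators.heatKernel (E := EuclideanSpace ℝ (Fin 3)) (ν * a) y) (-v)) (w - z) * F z := by
  have hK := (isSliceBoundKernel_backKernel_heatKernel (E := EuclideanSpace ℝ (Fin 3))).timeScale hν
  have h := duality_term_sliceBound_integrable (κ := fun a y => UnboundedOperators.heatKernel (ν * a) y)
    hK hg (X := fun z => heatDuhamelBack ν g z.1 z.2)
    (fun z _ => heatDuhamelBack_eq_convolution_heatKernel_nu hg hν z.1 z.2) hFi hFsupp
  rw [h]
  refine integral_congr_ae (Eventually.of_forall fun w => ?_)
  simp only [uncurry]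
  rw [convolution_reflect_eq_integral]

/-- **`∫ F ∂ᵥη = -∫ g̃ · Re (σᵥ(D) W₊ ⊛ F)`**, `σᵥ = 2πi⟪ξ, v⟫`. [folklore] -/
theorem pairing_fderiv_heatDuhamelBack_eq (v : EuclideanSpace ℝ (Fin 3)) :
    ∫ z, F z * fderiv ℝ (heatDuhamelBack ν g z.1) z.2 v =
      ∫ w, g w.1 w.2 * (-(multiplierHeatPotential ν (derivSymbol v) F w).re) := by
  have hK := (isSliceBoundKernel_backKernel_heatKernelGrad (E := EuclideanSpace ℝ (Fin 3)) v).timeScale hν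
  have h := duality_term_sliceBound_integrable (κ := fun a y => heatKernelGrad v (ν * a) y)
    hK hg (X := fun z => fderiv ℝ (heatDuhamelBack ν g z.1) z.2 v)
    (fun z _ => fderiv_heatDuhamelBack_eq_convolution_heatKernelGrad_nu hg hν z.1 z.2 v) hFi hFsupp
  rw [h]
  refine integral_congr_ae (Eventually.of_forall fun w => ?_)
  simp only [uncurry]
  rw [convolution_reflect_backKernel_heatKernelGrad hν v F w]

variable {r₀ r₁ : ℝ} (h₀ : 0 < r₀) (h₁ : r₀ < r₁)
include h₀ h₁

omit hFsupp in
/-- **`∫ F L = ∫ g̃ · heatPotential ν (∂_cλ-smeared F)`**, `L = 𝒰_ν[Λ ∂_c g]`, `λ = Δ((1-θ)Γ)`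
(for measurable `F`). [folklore] -/
theorem pairing_newtonFarSmoothing_eq (hFm : Measurable F) (c : EuclideanSpace ℝ (Fin 3)) :
    ∫ z, F z * heatDuhamelBack ν (fun t y => newtonFarSmoothing r₀ r₁ (fun y' => fderiv ℝ (g t) y' c) y) z.1 z.2 =
      ∫ w, g w.1 w.2 * heatPotential ν (fun q : ℝ × EuclideanSpace ℝ (Fin 3) =>
        ∫ y, fderiv ℝ (newtonFarLaplacian r₀ r₁) (y - q.2) c * F (q.1, y)) w := by
  have hK := ((isOffDiagKernel_backKernel_heatD1_newtonFarLaplacian h₀ h₁ c).of_univ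
    {y : EuclideanSpace ℝ (Fin 3) | (0 : ℝ) ≤ ‖y‖}).timeScale hν
  have h := (duality_term_offDiag (κ := fun a y => heatD1 (ν * a) c (newtonFarLaplacian r₀ r₁) y)
    (δ := 0) hK hg (A := univ) (Ag := univ) (fun _ _ _ => mem_univ _)
    (fun _ _ _ _ => norm_nonneg _)
    (X := fun z => heatDuhamelBack ν
      (fun t y => newtonFarSmoothing r₀ r₁ (fun y' => fderiv ℝ (g t) y' c) y) z.1 z.2)
    (fun z _ => heatDuhamelBack_newtonFarSmoothing_fderiv_eq_convolution_nu hg h₀ h₁ hν c z.1 z.2)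
    hFi (Eventually.of_forall fun _ _ => mem_univ _) isOpen_univ (fun _ _ _ _ => norm_nonneg _)).1
  rw [h]
  refine integral_congr_ae (Eventually.of_forall fun w => ?_)
  simp only [uncurry]
  rw [convolution_reflect_backKernel_heatD1 (contDiff_newtonFarLaplacian h₀ h₁ (n := ⊤))
    (hasCompactSupport_newtonFarLaplacian h₀.le h₁) hFm hFi hν c w]

/-- **`∫ F Ξ = ∫ g̃ · (w ↦ ∫ Ǩ₁(w - z) F(z) dz)`** with `Ǩ₁` the reflected backward kernel of
`a ↦ ∂_c e^{νaΔ}Γ₀` (far-field form). [folklore] -/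
theorem pairing_newtonNear_eq_reflect (c : EuclideanSpace ℝ (Fin 3)) :
    ∫ z, F z * heatDuhamelBack ν (fun t y => fderiv ℝ (newtonNearPotential r₀ r₁ (g t)) y c) z.1 z.2 =
      ∫ w, g w.1 w.2 * ∫ z, (fun v => backKernel
        (fun a y => heatD1 (ν * a) c (newtonNear r₀ r₁) y) (-v)) (w - z) * F z := by
  have hK := (isSliceBoundKernel_backKernel_heatD1_newtonNear h₀ h₁ c).timeScale hν
  have h := duality_term_sliceBound_integrable (κ := fun a y => heatD1 (ν * a) c (newtonNear r₀ r₁) y)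
    hK hg (X := fun z => heatDuhamelBack ν (fun t y => fderiv ℝ (newtonNearPotential r₀ r₁ (g t)) y c) z.1 z.2)
    (fun z _ => heatDuhamelBack_fderiv_newtonNearPotential_eq_convolution_nu hg h₀ h₁ hν c z.1 z.2)
    hFi hFsupp
  rw [h]
  refine integral_congr_ae (Eventually.of_forall fun w => ?_)
  simp only [uncurry]
  rw [convolution_reflect_eq_integral]

omit hFsupp in
/-- **`∫ F ∂ᵥΞ = ∫ g̃ · (w ↦ ∫ Ǩ₂(w - z) F(z) dz)`** with `Ǩ₂` the reflected backward kernel of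
`a ↦ ∂ᵥ∂_c e^{νaΔ}Γ₀`, when the spatial supports of `F` (in `A`) and of `g` (in `Ag`) are
`δ`-separated (far-field form). [folklore] -/
theorem pairing_fderiv_newtonNear_eq_reflect (v c : EuclideanSpace ℝ (Fin 3)) {δ : ℝ} (hδ : 0 < δ)
    {A Ag : Set (EuclideanSpace ℝ (Fin 3))} (hgA : ∀ t y, g t y ≠ 0 → y ∈ Ag)
    (hsep : ∀ a ∈ A, ∀ a' ∈ Ag, δ ≤ ‖a - a'‖)
    (hFA : ∀ᵐ z ∂(volume : Measure (ℝ × EuclideanSpace ℝ (Fin 3))), F z ≠ 0 → z.2 ∈ A)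
    (hFA' : ∀ z, F z ≠ 0 → z.2 ∈ A) :
    ∫ z, F z * fderiv ℝ (heatDuhamelBack ν (fun t y => fderiv ℝ (newtonNearPotential r₀ r₁ (g t)) y c) z.1) z.2 v =
      ∫ w, g w.1 w.2 * ∫ z, (fun v' => backKernel
        (fun a y => heatD2 (ν * a) v c (newtonNear r₀ r₁) y) (-v')) (w - z) * F z := by
  have hK := (isOffDiagKernel_backKernel_heatD2_newtonNear h₀ h₁ hδ v c).timeScale hν
  have h := (duality_term_offDiag (κ := fun a y => heatD2 (ν * a) v c (newtonNear r₀ r₁) y)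
    hK hg hgA hsep
    (X := fun z => fderiv ℝ (heatDuhamelBack ν (fun t y => fderiv ℝ (newtonNearPotential r₀ r₁ (g t)) y c) z.1) z.2 v)
    (fun z hz => fderiv_heatDuhamelBack_fderiv_newtonNearPotential_eq_convolution_nu hg h₀ h₁ hν v c hδ hgA
      z.1 z.2 (fun a' ha' => hsep z.2 (hFA' z hz) a' ha'))
    hFi hFA (U := ∅) isOpen_empty (fun z hz => absurd hz (Set.notMem_empty z))).1
  rw [h]
  refine integral_congr_ae (Eventually.of_forall fun w => ?_)
  simp only [uncurry]
  rw [convolution_reflect_eq_integral]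

omit hFsupp in
/-- **`∫ F ∂ᵤ∂ᵥΞ = ∫ g̃ · (-Re (Oseen multiplier potential of F) + heatPotential ν (profile-smeared F))`**
for unit-bounded directions and measurable `F` (the forward identification holds wherever the
reflected potential converges absolutely, which is the case a.e. on the support of `g̃` by the
joint integrability of the pairing). [folklore] -/
theorem pairing_fderiv_fderiv_newtonNear_eq (hFm : Measurable F)
    (hFsupp : ∀ᵐ z ∂(volume : Measure (ℝ × EuclideanSpace ℝ (Fin 3))), F z ≠ 0 → z.1 ∈ Icc a b)
    {u v c : EuclideanSpace ℝ (Fin 3)} (hu : ‖u‖ ≤ 1) (hv : ‖v‖ ≤ 1) (hc : ‖c‖ ≤ 1) :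
    ∫ z, F z * fderiv ℝ (fun x' => fderiv ℝ
      (heatDuhamelBack ν (fun t y => fderiv ℝ (newtonNearPotential r₀ r₁ (g t)) y c) z.1) x' v) z.2 u =
      ∫ w, g w.1 w.2 * (-(multiplierHeatPotential ν (oseenSymbol u v c) F w).re +
        heatPotential ν (fun q : ℝ × EuclideanSpace ℝ (Fin 3) =>
          ∫ y, newtonFarD3Profile r₀ r₁ u v c (y - q.2) * F (q.1, y)) w) := by
  obtain ⟨C, hC, hK1⟩ := exists_isSliceBoundKernel_backKernel_heatD3_newtonNear h₀ h₁ hu hv hc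
  have hK := hK1.timeScale hν
  have h := duality_term_sliceBound_integrable (κ := fun a y => heatD3 (ν * a) u v c (newtonNear r₀ r₁) y)
    hK hg (X := fun z => fderiv ℝ (fun x' => fderiv ℝ
      (heatDuhamelBack ν (fun t y => fderiv ℝ (newtonNearPotential r₀ r₁ (g t)) y c) z.1) x' v) z.2 u)
    (fun z _ => fderiv_fderiv_heatDuhamelBack_fderiv_newtonNearPotential_eq_convolution_nu hg h₀ h₁ hν
      hu hv hc z.1 z.2) hFi hFsupp
  rw [h]
  -- a.e. on the support of `g̃` the reflected potential converges absolutely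
  obtain ⟨M, hM0, hM⟩ := hg.exists_norm_le
  obtain ⟨a', b', hab'⟩ := hg.exists_time_support
  have hgi := hg.integrable_uncurry
  have hgM : ∀ᵐ w ∂(volume : Measure (ℝ × EuclideanSpace ℝ (Fin 3))), |uncurry g w| ≤ M :=
    Eventually.of_forall fun w => by rw [← Real.norm_eq_abs]; exact hM w.1 w.2
  have hgsupp : ∀ᵐ w ∂(volume : Measure (ℝ × EuclideanSpace ℝ (Fin 3))), uncurry g w ≠ 0 → w.1 ∈ Icc a' b' :=
    Eventually.of_forall fun w hw => by
      by_contra h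
      have h0 : g w.1 = 0 := hab' w.1 h
      exact hw (by simp [uncurry, h0])
  have hpair := hK.integrable_kernelPairing_swap hFi hFsupp hgi hM0 hgM hgsupp
  have hae := hpair.prod_left_ae
  refine integral_congr_ae ?_
  filter_upwards [hae] with w hw
  simp only [uncurry] at hw ⊢
  by_cases hgw : g w.1 w.2 = 0
  · simp [hgw]
  · have hw' : Integrable (fun z => backKernel (fun a y => heatD3 (ν * a) u v c (newtonNear r₀ r₁) y) (z - w) *
        F z) volume := by
      have h2 := hw.const_mul (g w.1 w.2)⁻¹
      refine h2.congr (Eventually.of_forall fun z => ?_)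
      show (g w.1 w.2)⁻¹ * (F z * (backKernel _ (z - w) * g w.1 w.2)) = _
      field_simp
    rw [convolution_reflect_backKernel_heatD3_newtonNear h₀ h₁ hν hu hv hc hFm hFi w hw']

end Pairings

end Literature.Analysis.FluidPDE
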